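import Literature.Barriers.CriticalPhenomena.SupercriticalSAWSpaceFillingWindowRateQuarter
import HarnessLib

/-!
# Barrier `SupercriticalSAWSpaceFilling`, twenty-fourth audit of `…Proofs`: the fugacity is rigid
# along schedules — an SLE_{8/3} limit along `x(δ)` certifies `x(δ) < x_c + δ^θ` eventually, for
# every `θ < 1/4`, and the space-filling above the window is uniform in the fugacity

Topic `Literature/Barriers/CriticalPhenomena`; companion of `SupercriticalSAWSpaceFilling` (Theorem 1
of H. Duminil-Copin, G. Kozma, A. Yadin, *Supercritical self-avoiding walks are space-filling*,
Ann. IHP Probab. Stat. 50 (2014) 315–326, arXiv:1110.3074), of the mechanism file `…Proofs` and of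
`…WindowRateQuarter` (gen 19 part B: the single schedule `x_c + δ^θ`, `0 < θ < 1/4`, is weakly
space-filling in the disc, so every fugacity WINDOW eventually as wide as `δ^θ` contains a bad
schedule).

This file turns the window statement (a CLASS of schedules contains a bad one) into its POINTWISE
form (every schedule outside the window is bad), the schedule analogue of the passage from
`¬ RobustSAWScalingLimit` to `∀ x > x_c, ¬ SAWScalingLimitAt x` (`…Unconditional`) and to
`SAWScalingLimitAt x → x = x_c` (`…Subcritical`):

* `SupercriticalSAW.isSpaceFillingLaws_of_rpow_le` — EVERY fugacity schedule `X` with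
  `X(δ) ≥ x_c + δ^θ` for small `δ` (`0 < θ < 1/4`; no upper bound, no regularity) is weakly
  space-filling in the unit disc (closest-site endpoints at `1, -1`). Input: the constants of the
  effective Theorem 6 of `…StepsNarrow` at a FIXED box scale `m` are monotone in the fugacity —
  the criterion `x^{18} Z_m(x)` and the rate `rateConst m x` increase, the prefactor `prefConst m x`
  decreases and the mesh threshold `meshThreshold m x a b` increases with `x`
  (`SupercriticalSAW.prefConst_anti`, `SupercriticalSAW.rateConst_mono`,
  `SupercriticalSAW.meshThreshold_mono`), because `Z_m` is a polynomial with nonnegative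
  coefficients (`Zbox_mono`) and the energy costs enter through `max(1, 1/x)`; so the certified
  scale `m(δ^θ)` of the schedule `x_c + δ^θ` (`SupercriticalSAW.schedule_hypotheses_sq`) serves
  every larger fugacity at the same mesh, with a smaller Peierls bound.
* `SupercriticalSAW.eventually_forall_lawAt_avoid_le` — the UNIFORM form: for every open
  `U ⊆ 𝔻` and `ε > 0`, for all small `δ`, `sup_{x ≥ x_c + δ^θ} P_{(𝔻_δ,a_δ,b_δ,x)}[γ_δ ∩ U = ∅] ≤ ε`.
* `SupercriticalSAW.not_convergesInLawToSLE_of_tendsto_avoid_along` — the core lemma of `…Proofs`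
  along an arbitrary non-trivial filter `l ≤ 𝓝[>] 0` (subsequences): avoidance probabilities of
  the balls of the domain tending to `0` along `l` exclude convergence in law (along `δ → 0⁺`) to
  any chordal SLE_κ curve missing a ball with positive probability.
* `SupercriticalSAW.eventually_lt_rpow_of_sawScalingLimitAlong` — **RIGIDITY**: if the fugacity-`X(δ)`
  SAW converges to chordal SLE_{8/3} in every Dobrushin domain (`SAWScalingLimitAlong X` of
  `…Narrow`), then `X(δ) < x_c + δ^θ` for all small `δ`, for every `0 < θ < 1/4` (apply the
  uniform space-filling to `max(X, x_c + δ^θ)` along the sub-filter where `X ≥ x_c + δ^θ`).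
  It contains the gen-19 statements `¬ SAWScalingLimitAlong (x_c + δ^θ)`
  (`not_sawScalingLimitAlong_rpow_quarter`) and `¬ WindowRobustSAWScalingLimit w` for `w ≥ δ^θ`
  (`SupercriticalSAWSpaceFillingRightUniform.windowRateQuarter`), and for constant schedules the
  right half `SAWScalingLimitAt x → x ≤ x_c` of `…ProofsOnto` / `…Subcritical`; new is
  `SupercriticalSAW.not_sawScalingLimitAlong_of_frequently_le` (schedules leaving the window
  along a subsequence only).
* `SupercriticalSAW.tendsto_law_avoid_of_rightUniform` — the finite-mesh form of the iterated-limit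
  obstruction of `…ProofsClosed`: a `δ`-UNIFORM right-continuity of `x ↦ P_{x,δ}[γ_δ ∩ U = ∅]` at
  `x_c` would make the CRITICAL family weakly space-fill `U`; so Problem 10 for the disc
  (`DKY2014_problem10_disk`, in particular the sub-problem, `…Problem10`) forbids any modulus of
  right-continuity in the fugacity that is uniform in the mesh — the near-critical window is not an
  artefact (`SupercriticalSAW.not_rightUniform_of_not_isSpaceFillingFamily`).

What is NOT proved here (bookkeeping for planners): the LEFT half of rigidity along schedules —
`SAWScalingLimitAlong X → x₀ < X(δ)` eventually for every `x₀ < x_c` — holds in substance by the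
subcritical length bound of `…SubcriticalLength` and the stochastic monotonicity of the length
(`lawAt_setOf_lt_length_mono`), but the thinness lemma of `…Subcritical` is stated along `𝓝[>] 0`
only; and a left RATE `x_c - δ^{θ'}` needs near-critical subcritical theory absent from the tree.

## References

* H. Duminil-Copin, G. Kozma, A. Yadin, *Supercritical self-avoiding walks are space-filling*,
  Ann. Inst. Henri Poincaré Probab. Stat. 50 (2014) 315–326, arXiv:1110.3074: §1 p. 2 (the weak
  sense of space-filling, Theorem 1), Theorem 6 and §3 (the Peierls estimate, `C(x,Ω)`, `c(x)`),
  §2 (Proposition 3, `Z_m(x)`), §4 p. 8 (Problem 10). [DuminilCopinKozmaYadin2014]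
* G. F. Lawler, O. Schramm, W. Werner, *On the scaling limit of planar self-avoiding walk* (2004),
  Prediction 2 (`ν = 3/4`, crossover `δ^{4/3}`). [LawlerSchrammWerner2004SAW]
* P. Billingsley, *Convergence of probability measures*, 2nd ed. (1999), Thm 2.1. [Billingsley1999]

Mathlib: `Filter.frequently_iff_neBot`, `Filter.Tendsto.mono_left`, `Filter.Tendsto.congr'`,
`ENNReal.tendsto_nhds_zero`, `tendsto_nhds_unique`, `div_le_div₀`, `Real.log_le_log`.
-/

noncomputable section

open MeasureTheory Filter Topology Metric Set Literature.Probability.LatticeModels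
  Literature.Probability.Percolation Literature.Probability.RandomPlanarGeometry
  Literature.Probability.RandomPlanarGeometry.SAW
open scoped ENNReal NNReal

namespace Literature.Barriers.CriticalPhenomena

namespace SupercriticalSAW

/-! ### Monotonicity of the effective constants in the fugacity (fixed box scale) -/

section Monotone

variable {m : ℕ} {x y : ℝ}

/-- The criterion `x^{18} Z_m(x)` of the effective Theorem 6 is nondecreasing in `x ≥ 0`
(`Z_m` is a polynomial with nonnegative coefficients). [cite: DuminilCopinKozmaYadin2014, §2 (definition of Z_m)] -/
theorem pow_mul_Zbox_le (m : ℕ) (hx : 0 ≤ x) (hxy : x ≤ y) :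
    x ^ 18 * Zbox m x ≤ y ^ 18 * Zbox m y :=
  mul_le_mul (pow_le_pow_left₀ hx hxy 18) (Zbox_mono m hx hxy) (Zbox_nonneg m hx)
    (pow_nonneg (hx.trans hxy) 18)

/-- `Z_m(x) > 0` once the criterion is positive. [folklore] -/
theorem Zbox_pos_of_pow_mul_pos (h : 0 < x ^ 18 * Zbox m x) (hx : 0 ≤ x) : 0 < Zbox m x :=
  pos_of_mul_pos_right h (pow_nonneg hx 18)

/-- The surgery constant `C₇(m, x) = 80(ρ+1) max(1,x⁻¹)^{10ρ+3}/Z_m(x)` is nonincreasing in the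
fugacity. [cite: DuminilCopinKozmaYadin2014, Proposition 7 (C(x,m))] -/
theorem C7_anti {r : ℕ} (hx : 0 < x) (hxy : x ≤ y) (hZ : 0 < Zbox m x) : C7 m r y ≤ C7 m r x := by
  have hmax : max 1 y⁻¹ ≤ max 1 x⁻¹ := max_le_max_left 1 (inv_anti₀ hx hxy)
  have hmax1 : (0 : ℝ) ≤ max 1 y⁻¹ := zero_le_one.trans (le_max_left _ _)
  have hρ : (0 : ℝ) ≤ 80 * ((rhoP m r : ℝ) + 1) := by positivity
  unfold C7
  refine div_le_div₀ (mul_nonneg hρ (pow_nonneg (zero_le_one.trans (le_max_left _ _)) _))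
    (mul_le_mul_of_nonneg_left (pow_le_pow_left₀ hmax1 hmax _) hρ) hZ (Zbox_mono m hx.le hxy)

/-- `C₇ ≥ 0` for `x ≥ 0`. [folklore] -/
theorem C7_nonneg {r : ℕ} (hx : 0 ≤ x) : 0 ≤ C7 m r x := by
  unfold C7
  exact div_nonneg (mul_nonneg (by positivity) (pow_nonneg (zero_le_one.trans (le_max_left _ _)) _))
    (Zbox_nonneg m hx)

/-- The main-term constant `A(m, x)` is nonincreasing in the fugacity. [folklore] -/
theorem Amain_anti {r : ℕ} (hx : 0 < x) (hxy : x ≤ y) (hZ : 0 < Zbox m x) :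
    Amain m r y ≤ Amain m r x := by
  have h := C7_anti (r := r) hx hxy hZ
  have hL : (0 : ℝ) ≤ (OddTile.side m r : ℝ) := Nat.cast_nonneg _
  unfold Amain
  exact mul_le_mul_of_nonneg_left (mul_le_mul_of_nonneg_left (mul_le_mul_of_nonneg_left
    (mul_le_mul_of_nonneg_right (mul_le_mul_of_nonneg_left h (by norm_num)) (by norm_num)) hL)
    (by norm_num)) (by norm_num)

/-- `A(m, x) ≥ 0` for `x ≥ 0`. [folklore] -/
theorem Amain_nonneg {r : ℕ} (hx : 0 ≤ x) : 0 ≤ Amain m r x := by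
  have h := C7_nonneg (m := m) (r := r) hx
  have hL : (0 : ℝ) ≤ (OddTile.side m r : ℝ) := Nat.cast_nonneg _
  unfold Amain
  exact mul_nonneg (by norm_num) (mul_nonneg (by norm_num) (mul_nonneg hL
    (mul_nonneg (mul_nonneg (by norm_num) h) (by norm_num))))

/-- **The prefactor `C(m, x)` of the effective Theorem 6 is nonincreasing in the fugacity.**
[cite: DuminilCopinKozmaYadin2014, Theorem 6 (C(x,Ω))] -/
theorem prefConst_anti (hx : 0 < x) (hxy : x ≤ y) (hZ : 0 < Zbox m x) :
    prefConst m y ≤ prefConst m x := by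
  unfold prefConst
  exact add_le_add (Amain_anti hx hxy hZ)
    (max_le_max_right 0 (div_le_div_of_nonneg_left (by norm_num) hZ (Zbox_mono m hx.le hxy)))

/-- `C(m, x) ≥ 0` for `x ≥ 0`. [folklore] -/
theorem prefConst_nonneg_of_nonneg (hx : 0 ≤ x) : 0 ≤ prefConst m x := by
  unfold prefConst
  exact add_nonneg (Amain_nonneg hx) (le_max_right _ _)

/-- **The rate `c(m, x)` of the effective Theorem 6 is nondecreasing in the fugacity.**
[cite: DuminilCopinKozmaYadin2014, Theorem 6 (c(x))] -/
theorem rateConst_mono (hx : 0 ≤ x) (hxy : x ≤ y) (hpos : 0 < x ^ 18 * Zbox m x) :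
    rateConst m x ≤ rateConst m y := by
  have hlog : Real.log (x ^ 18 * Zbox m x) ≤ Real.log (y ^ 18 * Zbox m y) :=
    Real.log_le_log hpos (pow_mul_Zbox_le m hx hxy)
  have hL1 : (1 : ℝ) ≤ OddTile.side m 4 := by exact_mod_cast OddTile.side_pos (m := m) (r := 4)
  have hL : (0 : ℝ) ≤ 16 * (OddTile.side m 4 : ℝ) ^ 2 := by positivity
  unfold rateConst
  exact min_le_min_left _ (div_le_div_of_nonneg_right (div_le_div_of_nonneg_right hlog hL) (by norm_num))

/-- **The mesh threshold `δ₀(m, x, a, b)` is nondecreasing in the fugacity** (once the criterion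
is `≥ 1`, so that its logarithm is nonnegative). [cite: DuminilCopinKozmaYadin2014, Theorem 6] -/
theorem meshThreshold_mono (hx : 0 < x) (hxy : x ≤ y) (hone : 1 ≤ x ^ 18 * Zbox m x) (a b : ℂ) :
    meshThreshold m x a b ≤ meshThreshold m y a b := by
  have hxZ : 0 < x ^ 18 * Zbox m x := by linarith
  have hlog : Real.log (x ^ 18 * Zbox m x) ≤ Real.log (y ^ 18 * Zbox m y) :=
    Real.log_le_log hxZ (pow_mul_Zbox_le m hx.le hxy)
  have hlog0 : 0 ≤ Real.log (y ^ 18 * Zbox m y) := (Real.log_nonneg hone).trans hlog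
  have hmax : max 1 y⁻¹ ≤ max 1 x⁻¹ := max_le_max_left 1 (inv_anti₀ hx hxy)
  have hlogmax : Real.log (max 1 y⁻¹) ≤ Real.log (max 1 x⁻¹) :=
    Real.log_le_log (lt_of_lt_of_le one_pos (le_max_left _ _)) hmax
  have hlogmax0 : 0 ≤ Real.log (max 1 y⁻¹) := Real.log_nonneg (le_max_left _ _)
  have hL1 : (1 : ℝ) ≤ OddTile.side m 4 := by exact_mod_cast OddTile.side_pos (m := m) (r := 4)
  have h43 : 0 < 43 * Real.log (max 1 y⁻¹) + 2 := by linarith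
  have hden_pos : 0 < 16 * (OddTile.side m 4 : ℝ) ^ 2 * (43 * Real.log (max 1 y⁻¹) + 2) :=
    mul_pos (by positivity) h43
  have hden_le : 16 * (OddTile.side m 4 : ℝ) ^ 2 * (43 * Real.log (max 1 y⁻¹) + 2) ≤
      16 * (OddTile.side m 4 : ℝ) ^ 2 * (43 * Real.log (max 1 x⁻¹) + 2) :=
    mul_le_mul_of_nonneg_left (by linarith) (by positivity)
  unfold meshThreshold
  refine min_le_min_left _ (min_le_min_left _ (min_le_min_left _ ?_))
  calc Real.log (x ^ 18 * Zbox m x) /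
        (16 * (OddTile.side m 4 : ℝ) ^ 2 * (43 * Real.log (max 1 x⁻¹) + 2))
      ≤ Real.log (y ^ 18 * Zbox m y) /
          (16 * (OddTile.side m 4 : ℝ) ^ 2 * (43 * Real.log (max 1 x⁻¹) + 2)) :=
        div_le_div_of_nonneg_right hlog (hden_pos.le.trans hden_le)
    _ ≤ Real.log (y ^ 18 * Zbox m y) /
          (16 * (OddTile.side m 4 : ℝ) ^ 2 * (43 * Real.log (max 1 y⁻¹) + 2)) :=
        div_le_div_of_nonneg_left hlog0 hden_pos hden_le

/-- **The effective Peierls bound is nonincreasing in the fugacity** at a fixed box scale: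
`C(m,y) δ⁻² e^{-c(m,y) s} ≤ C(m,x) δ⁻² e^{-c(m,x) s}` for `0 < x ≤ y`, `s ≥ 0`, once the criterion
is positive at `x`. [cite: DuminilCopinKozmaYadin2014, Theorem 6] -/
theorem peierlsBound_anti (hx : 0 < x) (hxy : x ≤ y) (hpos : 0 < x ^ 18 * Zbox m x) (δ : ℝ) {s : ℝ}
    (hs : 0 ≤ s) :
    prefConst m y / δ ^ 2 * Real.exp (-(rateConst m y * s)) ≤
      prefConst m x / δ ^ 2 * Real.exp (-(rateConst m x * s)) := by
  have hZ : 0 < Zbox m x := Zbox_pos_of_pow_mul_pos hpos hx.le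
  have hδ2 : 0 ≤ δ ^ 2 := sq_nonneg δ
  refine mul_le_mul (div_le_div_of_nonneg_right (prefConst_anti hx hxy hZ) hδ2) ?_
    (Real.exp_nonneg _) (div_nonneg (prefConst_nonneg_of_nonneg hx.le) hδ2)
  exact Real.exp_le_exp.2 (neg_le_neg (mul_le_mul_of_nonneg_right (rateConst_mono hx.le hxy hpos) hs))

end Monotone

/-! ### Every schedule above the window `x_c + δ^θ` is weakly space-filling -/

section Schedules

variable {θ : ℝ} {A B : ℝ → Site 2}

/-- `1 ≠ -1` in `ℂ` (a private copy of the helper of `…Crossing`). [folklore] -/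
private theorem one_ne_neg_one_C : (1 : ℂ) ≠ -1 := fun h => by
  have h' := congrArg Complex.re h
  norm_num at h'

/-- **Uniform space-filling above the window.** For `0 < θ < 1/4` and EVERY fugacity schedule
`X` with `X(δ) ≥ x_c + δ^θ` for small `δ` (no upper bound, no regularity in `δ`), the laws
`P_{(𝔻_δ,a_δ,b_δ,X(δ))}` (closest sites of `1, -1`) are weakly space-filling in the unit disc in
the sense of §1 of the source. The certified scale of the schedule `x_c + δ^θ`
(`schedule_hypotheses_sq`) is used at the larger fugacity `X(δ)`, where the criterion and the mesh
threshold are larger and the Peierls bound smaller (`peierlsBound_anti`).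
[cite: DuminilCopinKozmaYadin2014, Theorem 1 and Theorem 6] -/
theorem isSpaceFillingLaws_of_rpow_le (hθ0 : 0 < θ) (hθ : θ < 1 / 4) {X : ℝ → ℝ}
    (hXge : ∀ᶠ δ in 𝓝[>] (0 : ℝ), criticalFugacity + δ ^ θ ≤ X δ)
    (hAB : ∀ δ : ℝ, 0 < δ → IsClosestSite unitDisk δ 1 (A δ) ∧ IsClosestSite unitDisk δ (-1) (B δ)) :
    IsSpaceFillingLaws unitDisk A B fun δ => lawAt (X δ) unitDisk δ (A δ) (B δ) := by
  obtain ⟨C, hC, mOf, hmOf⟩ := exists_certifiedScaleFun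
  obtain ⟨hX, hξ, hrate⟩ := schedule_hypotheses_sq hθ0 hθ hC hmOf
  refine isSpaceFillingLaws_of_Zbox_schedule_sq (X := X) (M := fun δ => mOf (δ ^ θ)) (a := 1) (b := -1)
    norm_one (by simp) one_ne_neg_one_C hAB ?_ hξ fun r hr => ?_
  · filter_upwards [hX, hXge] with δ hXδ hle
    obtain ⟨hx0, h1600, hδlt⟩ := hXδ
    have hone : (1 : ℝ) ≤ (criticalFugacity + δ ^ θ) ^ 18 * Zbox (mOf (δ ^ θ)) (criticalFugacity + δ ^ θ) :=
      le_trans (by norm_num) h1600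
    exact ⟨hx0.trans_le hle, h1600.trans (pow_mul_Zbox_le _ hx0.le hle),
      hδlt.trans_le (meshThreshold_mono hx0 hle hone 1 (-1))⟩
  · refine tendsto_of_tendsto_of_tendsto_of_le_of_le' tendsto_const_nhds (hrate r hr) ?_ ?_
    · filter_upwards [hX, hXge] with δ hXδ hle
      exact mul_nonneg (div_nonneg (prefConst_nonneg_of_nonneg (hXδ.1.trans_le hle).le) (sq_nonneg δ))
        (Real.exp_nonneg _)
    · filter_upwards [hX, hXge] with δ hXδ hle
      obtain ⟨hx0, h1600, -⟩ := hXδ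
      have hpos : 0 < (criticalFugacity + δ ^ θ) ^ 18 * Zbox (mOf (δ ^ θ)) (criticalFugacity + δ ^ θ) := by
        linarith
      exact peierlsBound_anti hx0 hle hpos δ (sq_nonneg _)

/-- **The uniform form.** For `0 < θ < 1/4`, every open nonempty `U ⊆ 𝔻` and every `ε > 0`: for
all small `δ`, EVERY fugacity `x ≥ x_c + δ^θ` gives `P_{(𝔻_δ,a_δ,b_δ,x)}[γ_δ ∩ U = ∅] ≤ ε`
(closest sites of `1, -1`). Proof: otherwise choose a violating fugacity `X(δ)` at each bad mesh;
the schedule `X` is above the window, hence weakly space-filling (`isSpaceFillingLaws_of_rpow_le`).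
[cite: DuminilCopinKozmaYadin2014, Theorem 1] -/
theorem eventually_forall_lawAt_avoid_le (hθ0 : 0 < θ) (hθ : θ < 1 / 4)
    (hAB : ∀ δ : ℝ, 0 < δ → IsClosestSite unitDisk δ 1 (A δ) ∧ IsClosestSite unitDisk δ (-1) (B δ))
    {U : Set ℂ} (hU : IsOpen U) (hUΩ : U ⊆ unitDisk) (hUne : U.Nonempty) {ε : ℝ≥0∞} (hε : 0 < ε) :
    ∀ᶠ δ in 𝓝[>] (0 : ℝ), ∀ x : ℝ, criticalFugacity + δ ^ θ ≤ x →
      lawAt x unitDisk δ (A δ) (B δ) {γ | ∀ v ∈ γ.walk.support, meshPoint δ v ∉ U} ≤ ε := by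
  classical
  by_contra hnot
  have hfreq : ∃ᶠ δ in 𝓝[>] (0 : ℝ), ∃ x : ℝ, criticalFugacity + δ ^ θ ≤ x ∧
      ε < lawAt x unitDisk δ (A δ) (B δ) {γ | ∀ v ∈ γ.walk.support, meshPoint δ v ∉ U} := by
    rw [not_eventually] at hnot
    refine hnot.mono fun δ hδ => ?_
    push Not at hδ
    exact hδ
  -- a violating schedule above the window
  obtain ⟨X, hXge, hXbad⟩ : ∃ X : ℝ → ℝ, (∀ δ : ℝ, criticalFugacity + δ ^ θ ≤ X δ) ∧
      ∀ δ : ℝ, (∃ x : ℝ, criticalFugacity + δ ^ θ ≤ x ∧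
        ε < lawAt x unitDisk δ (A δ) (B δ) {γ | ∀ v ∈ γ.walk.support, meshPoint δ v ∉ U}) →
        ε < lawAt (X δ) unitDisk δ (A δ) (B δ) {γ | ∀ v ∈ γ.walk.support, meshPoint δ v ∉ U} := by
    refine ⟨fun δ => if h : ∃ x : ℝ, criticalFugacity + δ ^ θ ≤ x ∧
        ε < lawAt x unitDisk δ (A δ) (B δ) {γ | ∀ v ∈ γ.walk.support, meshPoint δ v ∉ U}
      then h.choose else criticalFugacity + δ ^ θ, fun δ => ?_, fun δ hδ => ?_⟩
    · dsimp only
      split_ifs with h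
      · exact h.choose_spec.1
      · exact le_rfl
    · dsimp only
      rw [dif_pos hδ]
      exact hδ.choose_spec.2
  have hfill := isSpaceFillingLaws_of_rpow_le hθ0 hθ (X := X) (Eventually.of_forall hXge) hAB U hU hUΩ hUne
  have hev : ∀ᶠ δ in 𝓝[>] (0 : ℝ),
      lawAt (X δ) unitDisk δ (A δ) (B δ) {γ | ∀ v ∈ γ.walk.support, meshPoint δ v ∉ U} ≤ ε :=
    ENNReal.tendsto_nhds_zero.1 hfill ε hε
  obtain ⟨δ, hδ, hle⟩ := (hfreq.and_eventually hev).exists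
  exact absurd hle (not_le.2 (hXbad δ hδ))

end Schedules

/-! ### The core lemma along a sub-filter, and rigidity of the fugacity along schedules -/

section Rigidity

variable {κ : ℝ≥0} {D : DobrushinDomain} {A B : ℝ → Site 2}

/-- **The core lemma of `…Proofs` along a sub-filter.** Let `l ≤ 𝓝[>] 0` be a non-trivial filter
(a "subsequence" of meshes). If the avoidance probability of every ball of the domain tends to `0`
ALONG `l` for a family of finite laws `P δ` on the SAWs of `Ω_δ`, and every chordal SLE_κ random
curve of `(D; a, b)` misses some ball `B(z, 2r)`, `B(z, r) ⊆ Ω`, with positive pre-Wiener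
probability, then the polylines do not converge in law (along `δ → 0⁺`) to chordal SLE_κ: the test
integrals `∫ F_{z,r} dP_δ` would converge along `l` both to `∫ F_{z,r}(Γ) dW > 0` and to `0`.
[cite: DuminilCopinKozmaYadin2014, §1 (When x > 1/μ)] -/
theorem not_convergesInLawToSLE_of_tendsto_avoid_along {l : Filter ℝ} [l.NeBot]
    (hl : l ≤ 𝓝[>] (0 : ℝ)) {P : ∀ δ : ℝ, Measure (DomainSAW D.carrier δ (A δ) (B δ))}
    [∀ δ, IsFiniteMeasure (P δ)]
    (hfill : ∀ (z : ℂ) (r : ℝ), 0 < r → ball z r ⊆ D.carrier →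
      Tendsto (fun δ => P δ {γ | ∀ v ∈ γ.walk.support, meshPoint δ v ∉ ball z r}) l (𝓝 0))
    (hmiss : ∀ Γ : (ℝ≥0 → ℝ) → CurveClass ℂ, IsSLECurve κ D Γ →
      ∃ z : ℂ, ∃ r : ℝ, 0 < r ∧ ball z r ⊆ D.carrier ∧
        Literature.Probability.Process.preWienerMeasure {ω | Disjoint (ball z (2 * r)) (Γ ω).range} ≠ 0) :
    ¬ ConvergesInLawToSLE κ D (fun δ (γ : DomainSAW D.carrier δ (A δ) (B δ)) => γ.curve) P := by
  haveI : IsProbabilityMeasure Literature.Probability.Process.preWienerMeasure :=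
    isProbabilityMeasure_preWienerMeasure'
  rintro ⟨Γ, hΓ, -, hT⟩
  obtain ⟨z, r, hr, hball, hpos⟩ := hmiss Γ hΓ
  -- along `l`, the test integrals converge to `∫ F(Γ) dW` …
  have hlim : Tendsto (fun δ => ∫ γ, missFunctional z r (DomainSAW.curve γ) ∂P δ) l
      (𝓝 (∫ ω, missFunctional z r (Γ ω) ∂Literature.Probability.Process.preWienerMeasure)) :=
    (hT (missFunctional z r)).mono_left hl
  -- … and to `0`
  have hu : Tendsto (fun δ => (P δ {γ | ∀ v ∈ γ.walk.support, meshPoint δ v ∉ ball z r}).toReal)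
      l (𝓝 0) := by
    have h := (ENNReal.tendsto_toReal ENNReal.zero_ne_top).comp (hfill z r hr hball)
    rwa [ENNReal.toReal_zero] at h
  have hzero : Tendsto (fun δ => ∫ γ, missFunctional z r (DomainSAW.curve γ) ∂P δ) l (𝓝 0) :=
    tendsto_of_tendsto_of_tendsto_of_le_of_le tendsto_const_nhds hu
      (fun δ => integral_nonneg fun γ => missFunctional_nonneg _ _ _)
      (fun δ => integral_missFunctional_curve_le hr _)
  have hL : ∫ ω, missFunctional z r (Γ ω) ∂Literature.Probability.Process.preWienerMeasure = 0 :=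
    tendsto_nhds_unique hlim hzero
  have hle := measureReal_le_integral_missFunctional
    (W := Literature.Probability.Process.preWienerMeasure) hΓ.aemeasurable hr (z := z)
  rw [hL] at hle
  exact absurd hle (not_le.2 (ENNReal.toReal_pos hpos (measure_ne_top _ _)))

/-- **Rigidity of the fugacity along schedules (right half, with a rate).** If the SAW with
fugacity `X(δ)` at mesh `δ` converges to chordal SLE_{8/3} in every Dobrushin domain with an
endpoint approximation (`SAWScalingLimitAlong X`), then for every `0 < θ < 1/4` eventually
`X(δ) < x_c + δ^θ`: an SLE_{8/3} limit along a schedule certifies that the schedule enters the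
right window of width `δ^θ` around `x_c = 1/μ(ℤ²)`. Proof: on the set `S` of meshes where
`X ≥ x_c + δ^θ`, assumed frequent, the schedule `max(X, x_c + δ^θ)` coincides with `X` and is
weakly space-filling in `(𝔻; 1, -1)` (`isSpaceFillingLaws_of_rpow_le`), so along the sub-filter
`𝓝[>] 0 ⊓ 𝓟 S` the `X`-laws avoid no ball — contradicting the SLE_{8/3} limit
(`not_convergesInLawToSLE_of_tendsto_avoid_along`; SLE_{8/3} misses a ball by [LSW03] Thm 6.1 and
the simplicity of the trace, both proved in the tree). [cite: DuminilCopinKozmaYadin2014, Theorem 1 and Conjecture 11] -/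
theorem eventually_lt_rpow_of_sawScalingLimitAlong {X : ℝ → ℝ} (h : SAWScalingLimitAlong X)
    {θ : ℝ} (hθ0 : 0 < θ) (hθ : θ < 1 / 4) :
    ∀ᶠ δ in 𝓝[>] (0 : ℝ), X δ < criticalFugacity + δ ^ θ := by
  by_contra hnot
  have hfreq : ∃ᶠ δ in 𝓝[>] (0 : ℝ), criticalFugacity + δ ^ θ ≤ X δ := by
    rw [not_eventually] at hnot
    exact hnot.mono fun δ hδ => not_lt.1 hδ
  haveI : (𝓝[>] (0 : ℝ) ⊓ 𝓟 {δ | criticalFugacity + δ ^ θ ≤ X δ}).NeBot :=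
    frequently_iff_neBot.1 hfreq
  have hl : 𝓝[>] (0 : ℝ) ⊓ 𝓟 {δ | criticalFugacity + δ ^ θ ≤ X δ} ≤ 𝓝[>] 0 := inf_le_left
  have hS : ∀ᶠ δ in 𝓝[>] (0 : ℝ) ⊓ 𝓟 {δ | criticalFugacity + δ ^ θ ≤ X δ},
      criticalFugacity + δ ^ θ ≤ X δ :=
    mem_inf_of_right (mem_principal_self _)
  obtain ⟨A, hA⟩ := exists_closestSiteFamily (1 : ℂ)
  obtain ⟨B, hB⟩ := exists_closestSiteFamily (-1 : ℂ)
  have hAB : ∀ δ : ℝ, 0 < δ →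
      IsClosestSite unitDisk δ 1 (A δ) ∧ IsClosestSite unitDisk δ (-1) (B δ) :=
    fun δ hδ => ⟨hA δ hδ, hB δ hδ⟩
  -- the modified schedule, above the window everywhere, equal to `X` on `S`
  have hfill' := isSpaceFillingLaws_of_rpow_le hθ0 hθ
    (X := fun δ => max (X δ) (criticalFugacity + δ ^ θ))
    (Eventually.of_forall fun δ => le_max_right _ _) hAB
  refine not_convergesInLawToSLE_of_tendsto_avoid_along (κ := (8 : ℝ≥0) / 3)
    (D := DobrushinDomain.unitDisc) (A := A) (B := B) hl
    (P := fun δ => lawAt (X δ) DobrushinDomain.unitDisc.carrier δ (A δ) (B δ))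
    (fun z r hr hball => ?_)
    (fun _ hΓ => hΓ.exists_ball_measure_disjoint_ne_zero sle_restriction_eightThirds_holds
      ae_isSimpleTrace_sleTrace_of_le_four_holds)
    (h DobrushinDomain.unitDisc A B (isEndpointApprox_unitDisc_of_isClosestSite hAB))
  have h1 := (hfill' (ball z r) isOpen_ball hball ⟨z, mem_ball_self hr⟩).mono_left hl
  refine h1.congr' ?_
  filter_upwards [hS] with δ hδ
  show lawAt (max (X δ) (criticalFugacity + δ ^ θ)) unitDisk δ (A δ) (B δ)
      {γ | ∀ v ∈ γ.walk.support, meshPoint δ v ∉ ball z r} =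
    lawAt (X δ) unitDisk δ (A δ) (B δ) {γ | ∀ v ∈ γ.walk.support, meshPoint δ v ∉ ball z r}
  rw [max_eq_left hδ]

/-- Every schedule FREQUENTLY above the window is excluded (not only eventually-above ones).
[cite: DuminilCopinKozmaYadin2014, Theorem 1] -/
theorem not_sawScalingLimitAlong_of_frequently_le {X : ℝ → ℝ} {θ : ℝ} (hθ0 : 0 < θ) (hθ : θ < 1 / 4)
    (hX : ∃ᶠ δ in 𝓝[>] (0 : ℝ), criticalFugacity + δ ^ θ ≤ X δ) : ¬ SAWScalingLimitAlong X :=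
  fun h => by
    have hev := eventually_lt_rpow_of_sawScalingLimitAlong h hθ0 hθ
    exact (hX.and_eventually hev).exists.elim fun δ hδ => absurd hδ.1 (not_le.2 hδ.2)

end Rigidity

/-! ### No mesh-uniform right-continuity of avoidance probabilities at `x_c` (finite-mesh form
of `…ProofsClosed`) -/

section RightContinuity

variable {A B : ℝ → Site 2}

/-- **A `δ`-uniform modulus of right-continuity in the fugacity at `x_c` forces the critical
family to fill.** If for an open nonempty `U ⊆ 𝔻` the avoidance probability satisfies, for every
`η > 0`, `P_{x_c,δ}[γ_δ ∩ U = ∅] ≤ P_{x,δ}[γ_δ ∩ U = ∅] + η` for all `x ∈ [x_c, x_c + ε(η)]` and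
all small `δ` (a right-continuity at `x_c` UNIFORM in the mesh), then the critical laws avoid `U`
with probability `→ 0`: at `x = x_c + δ^{1/8} ≤ x_c + ε` the right side is eventually `≤ 2η`
(`eventually_forall_lawAt_avoid_le`). The fixed-mesh continuity `continuousOn_lawAt_apply`
(`…LeftRobust`) is thus never uniform in `δ` across `x_c` unless the critical walk fills `U`.
[cite: DuminilCopinKozmaYadin2014, Theorem 1 and Problem 10] -/
theorem tendsto_law_avoid_of_rightUniform
    (hAB : ∀ δ : ℝ, 0 < δ → IsClosestSite unitDisk δ 1 (A δ) ∧ IsClosestSite unitDisk δ (-1) (B δ))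
    {U : Set ℂ} (hU : IsOpen U) (hUΩ : U ⊆ unitDisk) (hUne : U.Nonempty)
    (hcont : ∀ η : ℝ≥0∞, 0 < η → ∃ ε : ℝ, 0 < ε ∧ ∀ᶠ δ in 𝓝[>] (0 : ℝ), ∀ x : ℝ,
      criticalFugacity ≤ x → x ≤ criticalFugacity + ε →
        lawAt criticalFugacity unitDisk δ (A δ) (B δ) {γ | ∀ v ∈ γ.walk.support, meshPoint δ v ∉ U} ≤
          lawAt x unitDisk δ (A δ) (B δ) {γ | ∀ v ∈ γ.walk.support, meshPoint δ v ∉ U} + η) :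
    Tendsto (fun δ : ℝ =>
        lawAt criticalFugacity unitDisk δ (A δ) (B δ) {γ | ∀ v ∈ γ.walk.support, meshPoint δ v ∉ U})
      (𝓝[>] 0) (𝓝 0) := by
  rw [ENNReal.tendsto_nhds_zero]
  intro η hη
  have hη2 : 0 < η / 2 := ENNReal.half_pos hη.ne'
  obtain ⟨ε, hε, hev⟩ := hcont (η / 2) hη2
  have hθ0 : (0 : ℝ) < 1 / 8 := by norm_num
  have hunif := eventually_forall_lawAt_avoid_le (θ := 1 / 8) hθ0 (by norm_num) hAB hU hUΩ hUne hη2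
  have hsmall : ∀ᶠ δ in 𝓝[>] (0 : ℝ), δ ^ (1 / 8 : ℝ) ≤ ε := by
    have hc := (Real.continuousAt_rpow_const 0 (1 / 8 : ℝ) (Or.inr hθ0.le)).tendsto
    rw [Real.zero_rpow hθ0.ne'] at hc
    exact (hc.mono_left nhdsWithin_le_nhds).eventually (Iic_mem_nhds hε)
  have hpos : ∀ᶠ δ in 𝓝[>] (0 : ℝ), (0 : ℝ) < δ := self_mem_nhdsWithin
  filter_upwards [hev, hunif, hsmall, hpos] with δ hevδ hunifδ hsmallδ hδ
  have hx1 : criticalFugacity ≤ criticalFugacity + δ ^ (1 / 8 : ℝ) :=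
    le_add_of_nonneg_right (Real.rpow_nonneg hδ.le _)
  have hx2 : criticalFugacity + δ ^ (1 / 8 : ℝ) ≤ criticalFugacity + ε := by linarith
  calc lawAt criticalFugacity unitDisk δ (A δ) (B δ) {γ | ∀ v ∈ γ.walk.support, meshPoint δ v ∉ U}
      ≤ lawAt (criticalFugacity + δ ^ (1 / 8 : ℝ)) unitDisk δ (A δ) (B δ)
          {γ | ∀ v ∈ γ.walk.support, meshPoint δ v ∉ U} + η / 2 := hevδ _ hx1 hx2
    _ ≤ η / 2 + η / 2 := add_le_add (hunifδ _ le_rfl) le_rfl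
    _ = η := ENNReal.add_halves η

/-- Contrapositive, for planners: if the critical family is NOT weakly space-filling in the disc
(Problem 10 for `(𝔻; 1, -1)`, a consequence of the sub-problem by `…Problem10`), then some open
`U ⊆ 𝔻` admits NO mesh-uniform modulus of right-continuity of its avoidance probability at `x_c`.
[cite: DuminilCopinKozmaYadin2014, Problem 10] -/
theorem not_rightUniform_of_not_isSpaceFillingFamily
    (hAB : ∀ δ : ℝ, 0 < δ → IsClosestSite unitDisk δ 1 (A δ) ∧ IsClosestSite unitDisk δ (-1) (B δ))
    (h10 : ¬ IsSpaceFillingFamily criticalFugacity unitDisk A B) :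
    ∃ U : Set ℂ, IsOpen U ∧ U ⊆ unitDisk ∧ U.Nonempty ∧
      ¬ ∀ η : ℝ≥0∞, 0 < η → ∃ ε : ℝ, 0 < ε ∧ ∀ᶠ δ in 𝓝[>] (0 : ℝ), ∀ x : ℝ,
        criticalFugacity ≤ x → x ≤ criticalFugacity + ε →
          lawAt criticalFugacity unitDisk δ (A δ) (B δ) {γ | ∀ v ∈ γ.walk.support, meshPoint δ v ∉ U} ≤
            lawAt x unitDisk δ (A δ) (B δ) {γ | ∀ v ∈ γ.walk.support, meshPoint δ v ∉ U} + η := by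
  by_contra hall
  push Not at hall
  exact h10 fun U hU hUΩ hUne => tendsto_law_avoid_of_rightUniform hAB hU hUΩ hUne (hall U hU hUΩ hUne)

end RightContinuity

end SupercriticalSAW

open SupercriticalSAW

/-! ### The barrier entry -/

/-- **Barrier `SupercriticalSAWSpaceFillingRightUniform`** (twenty-fourth audit of `…Proofs`,
PROVED below): the fugacity of the sub-problem is RIGID along schedules — an SLE_{8/3} limit of
the fugacity-`X(δ)` SAW (every Dobrushin domain, every endpoint approximation) forces
`X(δ) < x_c + δ^θ` eventually, for every `0 < θ < 1/4`.

BARRIER (structured block, D-0021):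
- technique_class: SLE_{8/3} identification along ANY fugacity schedule `X(δ)` that is frequently (along some sequence of meshes `δ_k → 0`) at least `x_c + δ^θ` for some `θ < 1/4` — the pointwise form of the window class of `SupercriticalSAWSpaceFillingWindowRateQuarter` (every schedule outside the window, not just one per window), containing every constant fugacity `x > x_c` (`SupercriticalSAWSpaceFillingSubcritical`, right half), every tuned / data-driven / existentially quantified fugacity sequence (classes (x)–(xi) of the catalogue) in so far as it leaves the window along a subsequence, and subsequential identifications [cite: DuminilCopinKozmaYadin2014, Theorem 1]
- blocks: `SupercriticalSAW.SAWScalingLimitAlong X` for every such `X` (`SupercriticalSAW.not_sawScalingLimitAlong_of_frequently_le`); positively and UNIFORMLY in the fugacity: every schedule `X ≥ x_c + δ^θ` is weakly space-filling in `(𝔻; 1, -1)` (`SupercriticalSAW.isSpaceFillingLaws_of_rpow_le`) and `sup_{x ≥ x_c + δ^θ} P_{(𝔻_δ,a_δ,b_δ,x)}[γ_δ ∩ U = ∅] → 0` for every open `U ⊆ 𝔻` (`SupercriticalSAW.eventually_forall_lawAt_avoid_le`); consequently a mesh-UNIFORM modulus of right-continuity of an avoidance probability at `x_c` makes the critical family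 fill (`SupercriticalSAW.tendsto_law_avoid_of_rightUniform`), which Problem 10 for the disc forbids (`SupercriticalSAW.not_rightUniform_of_not_isSpaceFillingFamily`) — all unconditional (axioms `propext`, `Classical.choice`, `Quot.sound`)
- because: at a fixed box scale `m` the constants of the effective Theorem 6 (`SupercriticalSAW.DKY2014_thm6_disk_effective`) are monotone in the fugacity — `x^{18} Z_m(x)`, the rate `c(m,x)` and the mesh threshold `δ₀(m,x)` increase, the prefactor `C(m,x)` decreases (`SupercriticalSAW.prefConst_anti`, `SupercriticalSAW.rateConst_mono`, `SupercriticalSAW.meshThreshold_mono`: `Z_m` has nonnegative coefficients and the energy costs enter through `max(1, 1/x)`) — so the certified scale of the schedule `x_c + δ^θ` serves every larger fugacity [cite: DuminilCopinKozmaYadin2014, Theorem 6 and §3 (proof of Theorem 6)]; and the core portmanteau lemma of `…Proofs` holds along any non-trivial sub-filter of `δ → 0⁺` (`SupercriticalSAW.not_convergesInLawToSLE_of_tendsto_avoid_along`), applied to `max(X, x_c + δ^θ)` on the meshes where `X ≥ x_c + δ^θ` [cite: Billingsley1999, Thm 2.1]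
- evasions_known: schedules eventually inside `(x₀, x_c + δ^θ)` for all `θ < 1/4`, `x₀ < x_c`: the volume windows `|X - x_c| = O(δ²)` are equivalent to the sub-problem (`…Narrow`, `…VolumeWindow`), the band `δ² ≪ X - x_c ≲ δ^{1/4}` around the predicted crossover `δ^{4/3}` [cite: LawlerSchrammWerner2004SAW, Prediction 2] is undecided, and on the left only constant `x < x_c` are refuted by a declaration (`…Subcritical`), schedules `X(δ) ↑ x_c` being dead in substance (geodesic picture [cite: DuminilCopinKozmaYadin2014, §1 (When x < 1/μ)]) by no theorem
- scope_caveats: unit disc, `ℤ²`, closest-site endpoints of `1, -1` (any boundary pair `a ≠ b` would do after restating `schedule_hypotheses_sq`), chordal SLE_{8/3} (the inputs [LSW03] Thm 6.1 and simplicity for `κ ≤ 4` are proved in the tree; any SLE_κ, `κ < 8`, would do through `…Phases`); the exponent `1/4` and all constants are the tree's, not the source's [cite: DuminilCopinKozmaYadin2014, Theorem 1 and Theorem 6]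
- status: established (proved in the tree: `SupercriticalSAWSpaceFillingRightUniform_holds`)

[cite: DuminilCopinKozmaYadin2014, Theorem 1] -/
def SupercriticalSAWSpaceFillingRightUniform : Prop :=
  ∀ X : ℝ → ℝ, SupercriticalSAW.SAWScalingLimitAlong X →
    ∀ θ : ℝ, 0 < θ → θ < 1 / 4 → ∀ᶠ δ in 𝓝[>] (0 : ℝ), X δ < criticalFugacity + δ ^ θ

/-- **The rigidity barrier holds.** [cite: DuminilCopinKozmaYadin2014, Theorem 1] -/
theorem SupercriticalSAWSpaceFillingRightUniform_holds : SupercriticalSAWSpaceFillingRightUniform :=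
  fun _ h _ hθ0 hθ => eventually_lt_rpow_of_sawScalingLimitAlong h hθ0 hθ

/-- Rigidity contains the quarter window-rate entry (gen 19 part B): a window eventually `≥ δ^θ`,
`θ < 1/4`, contains the schedule `x_c + δ^{max(θ,1/8)}`, which rigidity excludes.
[cite: DuminilCopinKozmaYadin2014, Theorem 1] -/
theorem SupercriticalSAWSpaceFillingRightUniform.windowRateQuarter
    (h : SupercriticalSAWSpaceFillingRightUniform) : SupercriticalSAWSpaceFillingWindowRateQuarter := by
  intro θ hθ w hw hW
  set θ' : ℝ := max θ (1 / 8) with hθ'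
  have hθ'0 : 0 < θ' := lt_of_lt_of_le (by norm_num) (le_max_right _ _)
  have hθ'4 : θ' < 1 / 4 := max_lt hθ (by norm_num)
  have hIoo : ∀ᶠ δ in 𝓝[>] (0 : ℝ), δ ∈ Set.Ioo 0 1 := Ioo_mem_nhdsGT one_pos
  have hin : ∀ᶠ δ in 𝓝[>] (0 : ℝ), |criticalFugacity + δ ^ θ' - criticalFugacity| ≤ w δ := by
    filter_upwards [hw, hIoo] with δ hwδ hδ
    have h1 : δ ^ θ' ≤ δ ^ θ := Real.rpow_le_rpow_of_exponent_ge hδ.1 hδ.2.le (le_max_left _ _)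
    rw [add_sub_cancel_left, abs_of_nonneg (Real.rpow_nonneg hδ.1.le _)]
    exact h1.trans hwδ
  obtain ⟨δ, hδ⟩ := (h _ (hW (fun δ => criticalFugacity + δ ^ θ') hin) θ' hθ'0 hθ'4).exists
  have hδ' : criticalFugacity + δ ^ θ' < criticalFugacity + δ ^ θ' := hδ
  exact lt_irrefl _ hδ'

end Literature.Barriers.CriticalPhenomena
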